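import Mathlib.Topology.Algebra.Polynomial
import Mathlib.Topology.MetricSpace.Sequences
import Mathlib.Topology.MetricSpace.Bounded
import Mathlib.Analysis.SpecialFunctions.Log.Deriv
import Mathlib.Algebra.Polynomial.Roots
import Mathlib.Algebra.Polynomial.FieldDivision
import HarnessLib

/-!
# Upper semicontinuity of the real-root count, and the Gaussian weights as a limit

Topic `Literature/Analysis/Complex`; second support file for the discharge of
`Literature.Analysis.Complex.PolyaLaguerre_gaussian_CZDS` (`HutchinsonMultiplierProofs.lean`).
Laguerre's theorem is proved for polynomial multipliers `φ(k) = (k + β)^N`; the Gaussian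
multiplier `e^{-ck²}` is the coefficientwise limit of `(1 + ks)^N e^{-Nks}` with `N s² = 2c`,
`s → 0`, and the number of real roots counted with multiplicity can only go UP in a limit of
fixed degree (Pólya 1929, §2; Craven–Csordas 1995, proof of Laguerre's theorem for `φ ∈ L-P`).

## Contents (all proved, elementary real analysis)

* `LaguerreCZDS.abs_root_le`: a Cauchy-type bound for real roots from coefficient bounds.
* `LaguerreCZDS.le_card_roots_of_tendsto`: if `G_N → g` coefficientwise, `deg G_N ≤ deg g`, and
  every `G_N` has `≥ r` real roots (w.m.), then so does `g` (induction on `r`: extract a convergent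
  subsequence of roots, divide by the linear factor, recurse on the quotients).
* `LaguerreCZDS.tendsto_weights`: `(1 + ks_m)^{M_m} e^{-M_m k s_m} → e^{-ck²}` when
  `M_m s_m² = 2c`, `s_m → 0⁺` (second-order Taylor bound `Real.abs_log_sub_add_sum_range_le`).
* `LaguerreCZDS.card_roots_scale`, `natDegree_scale`, `coeff_scale`: `x ↦ ρx` rescaling.

## References

* G. Pólya, *Über einen Satz von Laguerre*, Jber. DMV 38 (1929) 161–168.
* T. Craven, G. Csordas, *Complex zero decreasing sequences*, Methods Appl. Anal. 2 (1995) 420–441.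
* T. H. Nguyen, A. Vishnyakova, arXiv:1903.09070, p. 3 Thm. C [NguyenVishnyakova2019].
-/

noncomputable section

namespace Literature.Analysis.Complex.LaguerreCZDS

open Polynomial Filter
open _root_.Topology

/-- **Root bound.** If `deg p ≤ n`, `|p_n| ≥ δ > 0` and `Σ_{k<n} |p_k| ≤ S`, every real root `t`
of `p` satisfies `|t| ≤ max 1 (S/δ)`. [folklore] -/
theorem abs_root_le {p : ℝ[X]} {n : ℕ} (hn : p.natDegree ≤ n) {t : ℝ} (ht : p.eval t = 0)
    {δ S : ℝ} (hδ : 0 < δ) (hδn : δ ≤ |p.coeff n|)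
    (hS : ∑ k ∈ Finset.range n, |p.coeff k| ≤ S) : |t| ≤ max 1 (S / δ) := by
  rcases le_or_gt |t| 1 with h1 | h1
  · exact h1.trans (le_max_left _ _)
  refine le_trans ?_ (le_max_right _ _)
  rw [le_div_iff₀ hδ]
  have heval : p.eval t = ∑ k ∈ Finset.range (n + 1), p.coeff k * t ^ k :=
    eval_eq_sum_range' (Nat.lt_succ_of_le hn) t
  rw [Finset.sum_range_succ, ht] at heval
  have hn0 : n ≠ 0 := by
    rintro rfl
    simp only [Finset.range_zero, Finset.sum_empty, pow_zero, mul_one, zero_add] at heval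
    rw [← heval, abs_zero] at hδn
    linarith
  obtain ⟨m, rfl⟩ : ∃ m, n = m + 1 := ⟨n - 1, by omega⟩
  have hsum : p.coeff (m + 1) * t ^ (m + 1)
      = -∑ k ∈ Finset.range (m + 1), p.coeff k * t ^ k := by linarith
  have key : |p.coeff (m + 1)| * |t| ^ (m + 1)
      ≤ (∑ k ∈ Finset.range (m + 1), |p.coeff k|) * |t| ^ m := by
    calc |p.coeff (m + 1)| * |t| ^ (m + 1)
        = |p.coeff (m + 1) * t ^ (m + 1)| := by rw [abs_mul, abs_pow]
      _ = |∑ k ∈ Finset.range (m + 1), p.coeff k * t ^ k| := by rw [hsum, abs_neg]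
      _ ≤ ∑ k ∈ Finset.range (m + 1), |p.coeff k * t ^ k| := Finset.abs_sum_le_sum_abs _ _
      _ ≤ ∑ k ∈ Finset.range (m + 1), |p.coeff k| * |t| ^ m := by
          refine Finset.sum_le_sum fun k hk => ?_
          rw [abs_mul, abs_pow]
          refine mul_le_mul_of_nonneg_left ?_ (abs_nonneg _)
          exact pow_le_pow_right₀ h1.le (Nat.lt_succ_iff.1 (Finset.mem_range.1 hk))
      _ = (∑ k ∈ Finset.range (m + 1), |p.coeff k|) * |t| ^ m := by rw [Finset.sum_mul]
  have htm : 0 < |t| ^ m := pow_pos (by linarith) m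
  have h2 : |p.coeff (m + 1)| * |t| * |t| ^ m
      ≤ (∑ k ∈ Finset.range (m + 1), |p.coeff k|) * |t| ^ m := by
    rw [mul_assoc, ← pow_succ']
    exact key
  have h3 : |p.coeff (m + 1)| * |t| ≤ ∑ k ∈ Finset.range (m + 1), |p.coeff k| :=
    le_of_mul_le_mul_right h2 htm
  calc |t| * δ ≤ |t| * |p.coeff (m + 1)| := mul_le_mul_of_nonneg_left hδn (abs_nonneg _)
    _ = |p.coeff (m + 1)| * |t| := mul_comm _ _
    _ ≤ ∑ k ∈ Finset.range (m + 1), |p.coeff k| := h3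
    _ ≤ S := hS

/-- **Upper semicontinuity of the number of real roots (with multiplicity) at fixed degree.**
If `G_N → g ≠ 0` coefficientwise, `deg G_N ≤ deg g = n`, and each `G_N` has at least `r` real
roots counted with multiplicity, then `g` has at least `r` real roots counted with multiplicity.
(Induction on `r`: a bounded sequence of roots `t_N` of `G_N` has a convergent subsequence
`t_{φN} → a`, `g(a) = 0`, and the quotients `G_{φN}/(X - t_{φN}) → g/(X - a)` coefficientwise.)
[folklore] -/
theorem le_card_roots_of_tendsto (r : ℕ) :
    ∀ (n : ℕ) (g : ℝ[X]) (G : ℕ → ℝ[X]), g ≠ 0 → g.natDegree = n →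
      (∀ N, (G N).natDegree ≤ n) →
      (∀ k, Tendsto (fun N => (G N).coeff k) atTop (𝓝 (g.coeff k))) →
      (∀ N, r ≤ Multiset.card (G N).roots) → r ≤ Multiset.card g.roots := by
  induction r with
  | zero => intros; exact Nat.zero_le _
  | succ r ih =>
    intro n g G hg hn hdeg hcoef hcard
    classical
    have hex : ∀ N, ∃ t, t ∈ (G N).roots := fun N =>
      Multiset.card_pos_iff_exists_mem.1 (Nat.lt_of_lt_of_le (Nat.succ_pos r) (hcard N))
    choose t ht using hex
    have hG0 : ∀ N, G N ≠ 0 := by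
      intro N h
      have h' := ht N
      rw [h, roots_zero] at h'
      simp at h'
    have htroot : ∀ N, (G N).eval (t N) = 0 := fun N => (mem_roots (hG0 N)).1 (ht N)
    -- the leading coefficient of `g`
    have hlc : g.coeff n ≠ 0 := by
      rw [← hn]
      exact fun h => hg (leadingCoeff_eq_zero.1 h)
    set δ : ℝ := |g.coeff n| / 2 with hδ
    have hδpos : 0 < δ := by positivity
    have hδlt : δ < |g.coeff n| := by
      have := abs_pos.2 hlc
      rw [hδ]; linarith
    set S : ℝ := ∑ k ∈ Finset.range n, (|g.coeff k| + 1) with hS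
    set B : ℝ := max 1 (S / δ) with hB
    -- the roots `t N` are eventually bounded by `B`
    have hev : ∀ᶠ N in atTop, t N ∈ Set.Icc (-B) B := by
      have h1 : ∀ᶠ N in atTop, δ ≤ |(G N).coeff n| :=
        ((continuous_abs.tendsto _).comp (hcoef n)).eventually_const_le hδlt
      have h2 : ∀ k, ∀ᶠ N in atTop, |(G N).coeff k| ≤ |g.coeff k| + 1 := fun k =>
        ((continuous_abs.tendsto _).comp (hcoef k)).eventually_le_const (lt_add_one _)
      have h3 : ∀ᶠ N in atTop, ∀ k ∈ Finset.range n, |(G N).coeff k| ≤ |g.coeff k| + 1 :=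
        (Filter.eventually_all_finset (Finset.range n)).2 fun k _ => h2 k
      filter_upwards [h1, h3] with N hN1 hN3
      exact abs_le.1 (abs_root_le (hdeg N) (htroot N) hδpos hN1 (Finset.sum_le_sum hN3))
    obtain ⟨a, -, φ, hφ, hta⟩ :=
      tendsto_subseq_of_frequently_bounded (Metric.isBounded_Icc (-B) B) hev.frequently
    -- `a` is a root of `g`
    have hlim : Tendsto (fun N => (G (φ N)).eval (t (φ N))) atTop (𝓝 (g.eval a)) := by
      have h1 : ∀ N, (G (φ N)).eval (t (φ N))
          = ∑ k ∈ Finset.range (n + 1), (G (φ N)).coeff k * (t (φ N)) ^ k := fun N =>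
        eval_eq_sum_range' (Nat.lt_succ_of_le (hdeg _)) _
      simp_rw [h1]
      rw [eval_eq_sum_range' (Nat.lt_succ_of_le hn.le) a]
      refine tendsto_finsetSum _ fun k _ => ?_
      exact ((hcoef k).comp hφ.tendsto_atTop).mul (hta.pow k)
    have heval : g.eval a = 0 := by
      have h2 : (fun N => (G (φ N)).eval (t (φ N))) = fun _ => (0 : ℝ) := funext fun N => htroot _
      rw [h2] at hlim
      exact (tendsto_nhds_unique tendsto_const_nhds hlim).symm
    -- `n ≥ 1`
    have hn1 : 1 ≤ n := by
      by_contra h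
      have h0 : g.natDegree = 0 := by omega
      have hgC := eq_C_of_natDegree_eq_zero h0
      rw [hgC, eval_C] at heval
      exact hg (by rw [hgC, heval, C_0])
    -- divide out the linear factors
    set g₁ : ℝ[X] := g /ₘ (X - C a) with hg₁
    have hgfac : (X - C a) * g₁ = g := mul_divByMonic_eq_iff_isRoot.2 heval
    set G₁ : ℕ → ℝ[X] := fun N => G (φ N) /ₘ (X - C (t (φ N))) with hG₁
    have hGfac : ∀ N, (X - C (t (φ N))) * G₁ N = G (φ N) := fun N =>
      mul_divByMonic_eq_iff_isRoot.2 (htroot _)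
    have hg₁0 : g₁ ≠ 0 := fun h => hg (by rw [← hgfac, h, mul_zero])
    have hg₁deg : g₁.natDegree = n - 1 := by
      rw [hg₁, natDegree_divByMonic _ (monic_X_sub_C a), natDegree_X_sub_C, hn]
    have hG₁deg : ∀ N, (G₁ N).natDegree ≤ n - 1 := fun N => by
      simp only [hG₁]
      rw [natDegree_divByMonic _ (monic_X_sub_C _), natDegree_X_sub_C]
      exact Nat.sub_le_sub_right (hdeg _) 1
    have hG₁card : ∀ N, r ≤ Multiset.card (G₁ N).roots := fun N => by
      have h := hcard (φ N)
      have hne : (X - C (t (φ N))) * G₁ N ≠ 0 := by rw [hGfac]; exact hG0 _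
      rw [← hGfac N, roots_mul hne, roots_X_sub_C, Multiset.card_add,
        Multiset.card_singleton] at h
      omega
    have hG₁coef : ∀ k, Tendsto (fun N => (G₁ N).coeff k) atTop (𝓝 (g₁.coeff k)) := by
      suffices hsuff : ∀ m k, n ≤ k + m →
          Tendsto (fun N => (G₁ N).coeff k) atTop (𝓝 (g₁.coeff k)) from
        fun k => hsuff n k (by omega)
      intro m
      induction m with
      | zero =>
        intro k hk
        have h1 : ∀ N, (G₁ N).coeff k = 0 := fun N =>
          coeff_eq_zero_of_natDegree_lt (by have := hG₁deg N; omega)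
        have h2 : g₁.coeff k = 0 := coeff_eq_zero_of_natDegree_lt (by omega)
        simp only [h1, h2]
        exact tendsto_const_nhds
      | succ m ihm =>
        intro k hk
        have hrec : ∀ N, (G₁ N).coeff k
            = (G (φ N)).coeff (k + 1) + t (φ N) * (G₁ N).coeff (k + 1) := fun N => by
          have h := congrArg (fun p : ℝ[X] => p.coeff (k + 1)) (hGfac N)
          simp only [coeff_X_sub_C_mul] at h
          linarith
        have hrec' : g₁.coeff k = g.coeff (k + 1) + a * g₁.coeff (k + 1) := by
          have h := congrArg (fun p : ℝ[X] => p.coeff (k + 1)) hgfac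
          simp only [coeff_X_sub_C_mul] at h
          linarith
        simp only [hrec]
        rw [hrec']
        exact ((hcoef (k + 1)).comp hφ.tendsto_atTop).add (hta.mul (ihm (k + 1) (by omega)))
    have hih := ih (n - 1) g₁ G₁ hg₁0 hg₁deg hG₁deg hG₁coef hG₁card
    have hne : (X - C a) * g₁ ≠ 0 := by rw [hgfac]; exact hg
    rw [← hgfac, roots_mul hne, roots_X_sub_C, Multiset.card_add, Multiset.card_singleton]
    omega

/-- **The Gaussian weights as a limit of Laguerre weights.** If `s_m > 0`, `s_m → 0` and
`M_m s_m² = 2c`, then `(1 + k s_m)^{M_m} e^{-M_m k s_m} → e^{-c k²}` for every `k : ℕ`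
(`log (1+u) = u - u²/2 + O(u³)`). [folklore] -/
theorem tendsto_weights {c : ℝ} (k : ℕ) {s : ℕ → ℝ} {M : ℕ → ℕ} (hs : ∀ m, 0 < s m)
    (hMs : ∀ m, (M m : ℝ) * s m ^ 2 = 2 * c) (hs0 : Tendsto s atTop (𝓝 0)) :
    Tendsto (fun m => (1 + k * s m) ^ (M m) * Real.exp (-(M m * (k * s m)))) atTop
      (𝓝 (Real.exp (-(c * (k : ℝ) ^ 2)))) := by
  set u : ℕ → ℝ := fun m => (k : ℝ) * s m with hu
  have hu0 : Tendsto u atTop (𝓝 0) := by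
    simpa using hs0.const_mul (k : ℝ)
  have hupos : ∀ m, 0 ≤ u m := fun m => mul_nonneg (Nat.cast_nonneg k) (hs m).le
  have hc0 : 0 ≤ c := by
    have := hMs 0
    nlinarith [sq_nonneg (s 0), mul_nonneg (Nat.cast_nonneg (M 0)) (sq_nonneg (s 0))]
  -- rewrite the weights through `exp`
  have heq : ∀ m, (1 + k * s m) ^ (M m) * Real.exp (-(M m * (k * s m)))
      = Real.exp ((M m : ℝ) * (Real.log (1 + u m) - u m + u m ^ 2 / 2) - c * (k : ℝ) ^ 2) := by
    intro m
    have h1 : 0 < 1 + u m := by linarith [hupos m]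
    have h2 : (1 + (k : ℝ) * s m) ^ (M m) = Real.exp ((M m : ℝ) * Real.log (1 + u m)) := by
      rw [Real.exp_nat_mul, Real.exp_log h1]
    rw [h2, ← Real.exp_add]
    congr 1
    have h3 : (M m : ℝ) * u m ^ 2 = 2 * c * (k : ℝ) ^ 2 := by
      simp only [hu]
      rw [mul_pow, ← hMs m]
      ring
    have h4 : (M m : ℝ) * ((k : ℝ) * s m) = (M m : ℝ) * u m := rfl
    rw [h4]
    linear_combination (-(1 / 2 : ℝ)) * h3
  simp_rw [heq]
  -- the exponent tends to `-c k²`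
  have hcore : Tendsto (fun m => (M m : ℝ) * (Real.log (1 + u m) - u m + u m ^ 2 / 2))
      atTop (𝓝 0) := by
    have hbound : ∀ᶠ m in atTop,
        ‖(M m : ℝ) * (Real.log (1 + u m) - u m + u m ^ 2 / 2)‖ ≤ 4 * c * (k : ℝ) ^ 3 * s m := by
      filter_upwards [hu0.eventually_le_const (show (0 : ℝ) < 1 / 2 by norm_num)] with m hm
      have hum : |-(u m)| < 1 := by rw [abs_neg, abs_of_nonneg (hupos m)]; linarith
      have hlog := Real.abs_log_sub_add_sum_range_le hum 2
      have hsum : (∑ i ∈ Finset.range 2, (-(u m)) ^ (i + 1) / (i + 1))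
          = -(u m) + u m ^ 2 / 2 := by
        simp [Finset.sum_range_succ]
        ring
      have h32 : u m ^ (2 + 1) = u m ^ 3 := by norm_num
      rw [hsum, sub_neg_eq_add, abs_neg, abs_of_nonneg (hupos m), h32] at hlog
      have h5 : |Real.log (1 + u m) - u m + u m ^ 2 / 2| ≤ u m ^ 3 / (1 - u m) := by
        have : Real.log (1 + u m) - u m + u m ^ 2 / 2
            = -(u m) + u m ^ 2 / 2 + Real.log (1 + u m) := by
          ring
        rw [this]; exact hlog
      have h6 : u m ^ 3 / (1 - u m) ≤ 2 * u m ^ 3 := by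
        rw [div_le_iff₀ (by linarith)]
        nlinarith [mul_nonneg (pow_nonneg (hupos m) 3) (by linarith : (0 : ℝ) ≤ 1 - 2 * u m)]
      have hM : (0 : ℝ) ≤ M m := Nat.cast_nonneg _
      rw [Real.norm_eq_abs, abs_mul, abs_of_nonneg hM]
      calc (M m : ℝ) * |Real.log (1 + u m) - u m + u m ^ 2 / 2|
          ≤ (M m : ℝ) * (2 * u m ^ 3) := mul_le_mul_of_nonneg_left (h5.trans h6) hM
        _ = 4 * c * (k : ℝ) ^ 3 * s m := by
            simp only [hu]
            have := hMs m
            linear_combination (2 * (k : ℝ) ^ 3 * s m) * this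
    refine squeeze_zero_norm' hbound ?_
    simpa using hs0.const_mul (4 * c * (k : ℝ) ^ 3)
  have h := (Real.continuous_exp.tendsto _).comp (hcore.sub_const (c * (k : ℝ) ^ 2))
  rwa [zero_sub] at h

/-- Rescaling `x ↦ ρ x` (`ρ ≠ 0`) and multiplying by a nonzero constant keep the number of real
roots counted with multiplicity. [folklore] -/
theorem card_roots_scale (Q : ℝ[X]) {μ ρ : ℝ} (hμ : μ ≠ 0) (hρ : ρ ≠ 0) :
    Multiset.card (C μ * Q.comp (C ρ * X)).roots = Multiset.card Q.roots := by
  rw [roots_C_mul _ hμ]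
  have h : C ρ * X = C ρ * X + C (0 : ℝ) := by simp
  rw [h, ← map_roots_comp_C_mul_X_add_C Q ρ 0 (isUnit_iff_ne_zero.2 hρ), Multiset.card_map]

/-- Rescaling keeps the degree. [folklore] -/
theorem natDegree_scale (Q : ℝ[X]) {μ ρ : ℝ} (hμ : μ ≠ 0) (hρ : ρ ≠ 0) :
    (C μ * Q.comp (C ρ * X)).natDegree = Q.natDegree := by
  rw [natDegree_C_mul hμ, natDegree_comp, natDegree_C_mul_X _ hρ, mul_one]

/-- Coefficients of the rescaled polynomial: `μ ρ^k Q_k`. [folklore] -/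
theorem coeff_scale (Q : ℝ[X]) (μ ρ : ℝ) (k : ℕ) :
    (C μ * Q.comp (C ρ * X)).coeff k = μ * ρ ^ k * Q.coeff k := by
  rw [coeff_C_mul, comp_C_mul_X_coeff]
  ring

end Literature.Analysis.Complex.LaguerreCZDS

end
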